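import Literature.AnabelianGeometry.AbsoluteAnabelian.AbsTopIII.ReconstructionThm19FunctorialAut
import HarnessLib

/-!
# `Thm_1_9aut'` — LAW CHECKS on the recorded geometric-automorphism datum, and conservativity (proof-only rider)

S. Mochizuki, *Topics in Absolute Anabelian Geometry III*, J. Math. Sci. Univ. Tokyo **22** (2015), Thm. 1.9 pp. 37–38
[cite: MochizukiAbsTopIII2015, Thm 1.9 pp.37-38]; Rmk. 1.9.5 (i) p. 39.

abc-iut cell; L4 lineage / ERRATA-L5 X-143 owner abc-iut-c312-2 gen 13, LIFTING INTO THE TREE the acceptance critic's kernel-checked law note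
(abc-iut-crit-A g7, scratch `pub/ideators/abc-iut-crit-A/Thm19Aut_Laws.lean` sha16 be68760d893066fb, 2026-08-29T05:17Z: «PASS AS TYPED … lift any
of it into an L4 rider if you want it in the tree») for ★ `ReconstructionThm19FunctorialAut` (`Thm_1_9aut'`): the aut-clause analogue of the
inner-clause rider `InitialThetaDataThm19FunctorialLaws` (★ p692006).  The datum `ρ.geomAut` must pass four LAWS, or `Thm_1_9aut' M ρ` is FALSE for
BOOKKEEPING (non-anabelian) reasons — all from the typed functoriality of `NFPortionAlgorithm` (`map_id`, `map_comp`) and the ONE (e)-comparison: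
A1 identity (`(Iso.refl, τ)` recorded ⇒ `τ` moves nothing), A2 composition (`(α,τ)`, `(β,σ)`, `(α ≪≫ β, υ)` recorded ⇒ `υ = σ ∘ τ`; ORDER: `map (α ≪≫ β)`
= `map α` then `map β`), A3 inner consistency (`(innerIso g, τ)` recorded ⇒ `τ = act i g`), A4 inverses (`(α,τ)`, `(α.symm, σ)` recorded ⇒ `σ ∘ τ = id`);
plus CONSERVATIVITY said plainly: where no geometric automorphism is recorded, `Thm_1_9aut' M ρ ↔ Thm_1_9' M ρ.toNFGaloisAction`.  READING for the
next datum item (the elliptic involution on `F̄(E)`): record `τ` as a HOMOMORPHIC assignment on the listed `α`, consistent with `act` on any inner `α`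
listed, never `(refl, τ ≠ 1)` — then the binder is refutable only by anabelian content, as intended.

PROOF-ONLY: no definition, no instance, no notation, no axiom, no `sorry`; nothing landed is edited.  A strengthened fact typed by name is a
HYPOTHESIS asserted by nobody; nothing of [AbsTopIII] is proved or refuted; no side on [IUTchIII] Cor. 3.12; count-neutral; nothing here asserts
that abc is proved or refuted.
-/

noncomputable section

open CategoryTheory

namespace Literature.AnabelianGeometry.AbsoluteAnabelian.AbsTopIII

universe u

namespace Thm_1_9aut'.Laws

variable {A : NFPortionAlgorithm.{u}} {M : CurveModel.{u}} {ρ : M.NFGaloisAutAction} {i : ρ.ι}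

/-- **Law A1 (identity).** If the datum records the IDENTITY isomorphism of `Π_U ↠ G_k` with a field automorphism
`τ` that moves something, no algorithm is aut-equivariant (`map_id`). [cite: MochizukiAbsTopIII2015, Thm 1.9 p.38] -/
theorem not_autEquivariantAt_of_refl_mem {τ : (M.NFFunctionField (ρ.curve i)) ≃+* (M.NFFunctionField (ρ.curve i))}
    (hp : ((Iso.refl (M.ext (ρ.curve i))), τ) ∈ ρ.geomAut i) (hmove : ∃ f : (M.NFFunctionField (ρ.curve i)), τ f ≠ f) :
    ¬ A.AutEquivariantAt M ρ i :=
  NFPortionAlgorithm.not_autEquivariantAt_of_map_eq_refl (p := (Iso.refl (M.ext (ρ.curve i)), τ)) hp (A.map_id _) hmove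

/-- **Law A2 (composition).** If `(α, τ)`, `(β, σ)` and `(α ≪≫ β, υ)` are all recorded, then `υ = σ ∘ τ` on the
nose, or no algorithm is aut-equivariant (`map_comp`). [cite: MochizukiAbsTopIII2015, Thm 1.9 p.38] -/
theorem not_autEquivariantAt_of_comp_mem {α β : (M.ext (ρ.curve i)) ≅ (M.ext (ρ.curve i))} {τ σ υ : (M.NFFunctionField (ρ.curve i)) ≃+* (M.NFFunctionField (ρ.curve i))}
    (hα : (α, τ) ∈ ρ.geomAut i) (hβ : (β, σ) ∈ ρ.geomAut i) (hαβ : (α ≪≫ β, υ) ∈ ρ.geomAut i)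
    (hne : ∃ f : (M.NFFunctionField (ρ.curve i)), υ f ≠ σ (τ f)) :
    ¬ A.AutEquivariantAt M ρ i := by
  rintro ⟨φ, -, hφ⟩
  obtain ⟨f, hf⟩ := hne
  have h1 := hφ _ hαβ (φ.symm f)
  have h2 := hφ _ hβ ((A.map α).funEquiv (φ.symm f))
  have h3 := hφ _ hα (φ.symm f)
  simp only [RingEquiv.apply_symm_apply] at h1 h3
  rw [A.map_comp, RingEquiv.trans_apply] at h1
  simp only at h2
  rw [h2, h3] at h1
  exact hf h1.symm

/-- **Law A3 (inner consistency).** If an INNER isomorphism `innerIso g` is recorded as geometric with `τ`, then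
`τ = act i g` on the nose, or no algorithm is aut-equivariant (ONE comparison serves both clauses). [cite: MochizukiAbsTopIII2015, Thm 1.9 p.38] -/
theorem not_autEquivariantAt_of_innerIso_mem {g : (M.ext (ρ.curve i)).arith} {τ : (M.NFFunctionField (ρ.curve i)) ≃+* (M.NFFunctionField (ρ.curve i))}
    (hp : ((M.ext (ρ.curve i)).innerIso g, τ) ∈ ρ.geomAut i) (hne : ∃ f : (M.NFFunctionField (ρ.curve i)), τ f ≠ ρ.act i g f) :
    ¬ A.AutEquivariantAt M ρ i := by
  rintro ⟨φ, hin, hφ⟩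
  obtain ⟨f, hf⟩ := hne
  have h1 := hφ _ hp (φ.symm f)
  have h2 := hin g (φ.symm f)
  simp only [RingEquiv.apply_symm_apply] at h1 h2
  rw [h2] at h1
  exact hf h1.symm

/-- **Law A4 (inverses).** If `(α, τ)` and `(α.symm, σ)` are both recorded, then `σ ∘ τ = id`, or no algorithm is
aut-equivariant (`map_comp` + `map_id` on `α ≪≫ α.symm = refl`). [cite: MochizukiAbsTopIII2015, Thm 1.9 p.38] -/
theorem not_autEquivariantAt_of_symm_mem {α : (M.ext (ρ.curve i)) ≅ (M.ext (ρ.curve i))} {τ σ : (M.NFFunctionField (ρ.curve i)) ≃+* (M.NFFunctionField (ρ.curve i))}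
    (hα : (α, τ) ∈ ρ.geomAut i) (hα' : (α.symm, σ) ∈ ρ.geomAut i) (hne : ∃ f : (M.NFFunctionField (ρ.curve i)), σ (τ f) ≠ f) :
    ¬ A.AutEquivariantAt M ρ i := by
  rintro ⟨φ, -, hφ⟩
  obtain ⟨f, hf⟩ := hne
  have hcomp : (A.map (α ≪≫ α.symm)).funEquiv = (A.map α).funEquiv.trans (A.map α.symm).funEquiv :=
    A.map_comp α α.symm
  rw [Iso.self_symm_id, A.map_id] at hcomp
  have hx : (A.map α.symm).funEquiv ((A.map α).funEquiv (φ.symm f)) = φ.symm f := by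
    have := congrArg (fun e : _ ≃+* _ => e (φ.symm f)) hcomp
    simpa [RingEquiv.trans_apply] using this.symm
  have h2 := hφ _ hα' ((A.map α).funEquiv (φ.symm f))
  have h3 := hφ _ hα (φ.symm f)
  simp only [RingEquiv.apply_symm_apply] at h3
  rw [hx, RingEquiv.apply_symm_apply, h3] at h2
  exact hf h2.symm

/-- Packaging: any law violation at a recorded Thm-1.9 input curve refutes the NAMED FACT `Thm_1_9aut' M ρ` for that
datum — for bookkeeping reasons, saying nothing about [AbsTopIII].  (A1 shown; A2–A4 package identically.) [cite: MochizukiAbsTopIII2015, Thm 1.9 p.38] -/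
theorem not_thm_1_9aut'_of_refl_mem (hin : M.IsThm19Input (ρ.curve i)) {τ : (M.NFFunctionField (ρ.curve i)) ≃+* (M.NFFunctionField (ρ.curve i))}
    (hp : ((Iso.refl (M.ext (ρ.curve i))), τ) ∈ ρ.geomAut i) (hmove : ∃ f : (M.NFFunctionField (ρ.curve i)), τ f ≠ f) :
    ¬ Thm_1_9aut' M ρ := fun ⟨_, hA⟩ =>
  not_autEquivariantAt_of_refl_mem hp hmove (hA.2 i hin)

/-- Packaging of the corresponding law: a violation at a recorded Thm-1.9 input curve refutes the NAMED FACT `Thm_1_9aut' M ρ` for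
that datum — for bookkeeping (non-anabelian) reasons, saying nothing about [AbsTopIII]. (`not_thm_1_9aut'_of_comp_mem`) [cite: MochizukiAbsTopIII2015, Thm 1.9 p.38] -/
theorem not_thm_1_9aut'_of_comp_mem (hin : M.IsThm19Input (ρ.curve i)) {α β : (M.ext (ρ.curve i)) ≅ (M.ext (ρ.curve i))} {τ σ υ : (M.NFFunctionField (ρ.curve i)) ≃+* (M.NFFunctionField (ρ.curve i))}
    (hα : (α, τ) ∈ ρ.geomAut i) (hβ : (β, σ) ∈ ρ.geomAut i) (hαβ : (α ≪≫ β, υ) ∈ ρ.geomAut i)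
    (hne : ∃ f : (M.NFFunctionField (ρ.curve i)), υ f ≠ σ (τ f)) :
    ¬ Thm_1_9aut' M ρ := fun ⟨_, hA⟩ =>
  not_autEquivariantAt_of_comp_mem hα hβ hαβ hne (hA.2 i hin)

/-- Packaging of the corresponding law: a violation at a recorded Thm-1.9 input curve refutes the NAMED FACT `Thm_1_9aut' M ρ` for
that datum — for bookkeeping (non-anabelian) reasons, saying nothing about [AbsTopIII]. (`not_thm_1_9aut'_of_innerIso_mem`) [cite: MochizukiAbsTopIII2015, Thm 1.9 p.38] -/
theorem not_thm_1_9aut'_of_innerIso_mem (hin : M.IsThm19Input (ρ.curve i)) {g : (M.ext (ρ.curve i)).arith} {τ : (M.NFFunctionField (ρ.curve i)) ≃+* (M.NFFunctionField (ρ.curve i))}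
    (hp : ((M.ext (ρ.curve i)).innerIso g, τ) ∈ ρ.geomAut i) (hne : ∃ f : (M.NFFunctionField (ρ.curve i)), τ f ≠ ρ.act i g f) :
    ¬ Thm_1_9aut' M ρ := fun ⟨_, hA⟩ =>
  not_autEquivariantAt_of_innerIso_mem hp hne (hA.2 i hin)

/-- Packaging of the corresponding law: a violation at a recorded Thm-1.9 input curve refutes the NAMED FACT `Thm_1_9aut' M ρ` for
that datum — for bookkeeping (non-anabelian) reasons, saying nothing about [AbsTopIII]. (`not_thm_1_9aut'_of_symm_mem`) [cite: MochizukiAbsTopIII2015, Thm 1.9 p.38] -/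
theorem not_thm_1_9aut'_of_symm_mem (hin : M.IsThm19Input (ρ.curve i)) {α : (M.ext (ρ.curve i)) ≅ (M.ext (ρ.curve i))} {τ σ : (M.NFFunctionField (ρ.curve i)) ≃+* (M.NFFunctionField (ρ.curve i))}
    (hα : (α, τ) ∈ ρ.geomAut i) (hα' : (α.symm, σ) ∈ ρ.geomAut i) (hne : ∃ f : (M.NFFunctionField (ρ.curve i)), σ (τ f) ≠ f) :
    ¬ Thm_1_9aut' M ρ := fun ⟨_, hA⟩ =>
  not_autEquivariantAt_of_symm_mem hα hα' hne (hA.2 i hin)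

/-- **Conservativity at the current named pairs, said plainly**: where the datum records no geometric automorphism,
`Thm_1_9aut' M ρ ↔ Thm_1_9' M ρ.toNFGaloisAction` — the new binder adds exactly nothing until a pair `(α, τ)` with
`τ` moving a transcendental (the elliptic involution) is typed. [cite: MochizukiAbsTopIII2015, Thm 1.9 p.38] -/
theorem thm_1_9aut'_iff_thm_1_9'_of_geomAut_eq_empty (hρ : ∀ i, ρ.geomAut i = ∅) :
    Thm_1_9aut' M ρ ↔ Thm_1_9' M ρ.toNFGaloisAction :=
  ⟨Thm_1_9aut'.toThm_1_9', fun ⟨A, hA⟩ => ⟨A, hA.toWitnessedByAut_of_geomAut_eq_empty hρ⟩⟩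

end Thm_1_9aut'.Laws

end Literature.AnabelianGeometry.AbsoluteAnabelian.AbsTopIII

end
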